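import Summits.CriticalPhenomena.PercolationContinuityZ3.Cruxes.FreeBoxSparse.SketchIdeator1

/-!
# Triage r1-1 (gen 2) scratch — typed sharpenings for crux stmt-CriticalPhenomena-4445 (`FreeBoxSparse`)

* §1 cards `lss-bgn-gluing-ceiling` / `ccfs-window-kissing-walls` (one merged line): the **K_max form**
  of the coarse bond event.  `goodPair_subset_goodPairMax` (proved): the card's every-dense-to-every-dense
  event is contained in the largest-to-largest event, so the Max-ceiling implies the card's ceiling
  (`gluingCeiling_of_max`, proved) while the Max-residual ("the two LARGEST clusters of adjacent boxes
  glue") is weaker than the card's residual (which also obliges all secondary δ′-dense pieces to glue).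
  Chains of `GoodPairMax` bonds are transitive through the connected largest cluster of the middle box,
  so the LSS/DST + BGN proof of the ceiling is unchanged.
* §2 card `critical-quantile-ladder`: the ladder consumes only typical-value GROWTH
  (`SuperFractalGrowth`), which follows from a giant-FRACTION event at probability ≥ 1/2
  (`SuperFractalGiantFraction`) — a quarter of the fat sub-box mass in one cluster — instead of the
  card's all-pairs `Cohere` (whose per-sub-box isolation budget is ≤ 2⁻⁶², triager 2).
* §3 card `blocking-quarantine-wiring`: its second Transfer proves the conjunct outright (typed).
-/

noncomputable section
open MeasureTheory Filter Topology
open Literature.Probability.Percolation Literature.Probability.LatticeModels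
open Summit.CriticalPhenomena.PercolationContinuityZ3.Cruxes.FreeBoxSparse.Sketch
open scoped Classical

namespace Summit.CriticalPhenomena.PercolationContinuityZ3.Cruxes.FreeBoxSparse.TriageR1K1g2

/-! ## §1 The K_max form of the gluing ceiling -/

/-- `x` carries a LARGEST free cluster of `Λ` (ties allowed). -/
def IsMaxVertex (Λ : Finset V3) (ω : BondConfig V3) (x : V3) : Prop :=
  ∀ x' ∈ Λ, inClusterCard Λ ω x' ≤ inClusterCard Λ ω x

/-- Card 2's coarse bond event `GoodPair_n(δ)` (every dense to every dense), as a named set. -/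
def GoodPair (n : ℕ) (δ : ℝ) : Set (BondConfig V3) :=
  {ω | (∃ x ∈ box 3 n, IsDense δ (box 3 n) ω x) ∧
       (∃ y ∈ boxAt (shiftVec n) n, IsDense δ (boxAt (shiftVec n) n) ω y) ∧
       ∀ x ∈ box 3 n, ∀ y ∈ boxAt (shiftVec n) n,
         IsDense δ (box 3 n) ω x → IsDense δ (boxAt (shiftVec n) n) ω y →
           ω ∈ openConnIn ((↑(box 3 n) : Set V3) ∪ ↑(boxAt (shiftVec n) n)) x y}

/-- **K_max form**: the largest free clusters of the two adjacent boxes are `δ`-dense and every largest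
cluster of one is joined INSIDE THE UNION to every largest cluster of the other. -/
def GoodPairMax (n : ℕ) (δ : ℝ) : Set (BondConfig V3) :=
  {ω | (∃ x ∈ box 3 n, IsMaxVertex (box 3 n) ω x ∧ IsDense δ (box 3 n) ω x) ∧
       (∃ y ∈ boxAt (shiftVec n) n, IsMaxVertex (boxAt (shiftVec n) n) ω y ∧
          IsDense δ (boxAt (shiftVec n) n) ω y) ∧
       ∀ x ∈ box 3 n, ∀ y ∈ boxAt (shiftVec n) n,
         IsMaxVertex (box 3 n) ω x → IsMaxVertex (boxAt (shiftVec n) n) ω y →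
           ω ∈ openConnIn ((↑(box 3 n) : Set V3) ∪ ↑(boxAt (shiftVec n) n)) x y}

/-- A largest cluster is dense as soon as some cluster is. -/
theorem isDense_of_isMaxVertex {Λ : Finset V3} {ω : BondConfig V3} {δ : ℝ} {x x₀ : V3}
    (hx : IsMaxVertex Λ ω x) (hx₀ : x₀ ∈ Λ) (hd : IsDense δ Λ ω x₀) : IsDense δ Λ ω x := by
  unfold IsDense at *
  exact hd.trans (by exact_mod_cast hx x₀ hx₀)

/-- A nonempty box has a largest free cluster. -/
theorem exists_isMaxVertex {Λ : Finset V3} (hΛ : Λ.Nonempty) (ω : BondConfig V3) :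
    ∃ x ∈ Λ, IsMaxVertex Λ ω x := by
  obtain ⟨x, hx, hmax⟩ := Finset.exists_max_image Λ (inClusterCard Λ ω) hΛ
  exact ⟨x, hx, hmax⟩

/-- **`GoodPair ⊆ GoodPairMax`.** -/
theorem goodPair_subset_goodPairMax (n : ℕ) (δ : ℝ) : GoodPair n δ ⊆ GoodPairMax n δ := by
  rintro ω ⟨⟨x₀, hx₀, hdx₀⟩, ⟨y₀, hy₀, hdy₀⟩, hall⟩
  obtain ⟨x, hx, hmx⟩ := exists_isMaxVertex ⟨x₀, hx₀⟩ ω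
  obtain ⟨y, hy, hmy⟩ := exists_isMaxVertex ⟨y₀, hy₀⟩ ω
  refine ⟨⟨x, hx, hmx, isDense_of_isMaxVertex hmx hx₀ hdx₀⟩,
    ⟨y, hy, hmy, isDense_of_isMaxVertex hmy hy₀ hdy₀⟩, ?_⟩
  intro x' hx' y' hy' hmx' hmy'
  exact hall x' hx' y' hy' (isDense_of_isMaxVertex hmx' hx₀ hdx₀)
    (isDense_of_isMaxVertex hmy' hy₀ hdy₀)

/-- The ceiling in K_max form (same LSS/DST + BGN proof as the card's `GluingCeiling`: `GoodPairMax`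
is determined by the edges of the union, chains lift through the connected largest cluster). -/
def GluingCeilingMax : Prop :=
  ∃ ε : ℝ, 0 < ε ∧ ∀ δ : ℝ, 0 < δ → ∀ n : ℕ, 1 ≤ n →
    (bondPercolation (zdGraph 3) (criticalProbI 3)).real (GoodPairMax n δ) ≤ 1 - ε

/-- Checked: the Max-ceiling implies the card's ceiling. -/
theorem gluingCeiling_of_max (h : GluingCeilingMax) : GluingCeiling := by
  obtain ⟨ε, hε, hC⟩ := h
  refine ⟨ε, hε, fun δ hδ n hn => ?_⟩
  have hmono := measureReal_mono (μ := bondPercolation (zdGraph 3) (criticalProbI 3))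
    (goodPair_subset_goodPairMax n δ) (measure_ne_top _ _)
  exact hmono.trans (hC δ hδ n hn)

/-- The Max-residual (repaired quantifiers, threshold form at THE ceiling constant `ε₀`): for every
density, eventually "both largest clusters `δ`-dense but some largest pair unglued in the union" has
probability `< ε₀/2`.  `AdjacentMaxUngluedRare ε₀ ∧ (Max-ceiling at ε₀) ⇒ FreeBoxSparse` by boosting
(`¬FBS ⇒` a scale with `P(K_max δ′-dense) ≥ 1 - ε₀/4` in each box i.o.). -/
def AdjacentMaxUngluedRare (ε₀ : ℝ) : Prop :=
  ∀ δ : ℝ, 0 < δ → ∀ᶠ n : ℕ in atTop,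
    (bondPercolation (zdGraph 3) (criticalProbI 3)).real
      {ω | ∃ x ∈ box 3 n, ∃ y ∈ boxAt (shiftVec n) n,
           IsMaxVertex (box 3 n) ω x ∧ IsMaxVertex (boxAt (shiftVec n) n) ω y ∧
           IsDense δ (box 3 n) ω x ∧ IsDense δ (boxAt (shiftVec n) n) ω y ∧
           ω ∉ openConnIn ((↑(box 3 n) : Set V3) ∪ ↑(boxAt (shiftVec n) n)) x y}
      < ε₀ / 2

/-! ## §2 The honest residual of the quantile ladder: growth / giant fraction, not all-pairs coherence -/

/-- Largest free-box cluster `|K_max^free(Λ_n)|`. -/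
def freeMax (n : ℕ) (ω : BondConfig V3) : ℕ := (box 3 n).sup (inClusterCard (box 3 n) ω)

/-- Hutchcroft's typical value `M_n(p) = min{m : P_p(freeMax_n ≥ m) ≤ e⁻¹}` (as in Sketch-ideator3). -/
def freeTypicalMax (p : unitInterval) (n : ℕ) : ℕ :=
  sInf {m : ℕ | (bondPercolation (zdGraph 3) p).real {ω | m ≤ freeMax n ω} ≤ Real.exp (-1)}

/-- **SuperFractalGrowth** — exactly what the ladder + sharpness consume (the card's `CardB_step1`
conclusion, with room in the constants): in the regime, one scale step multiplies the typical value by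
`L³/80 > (L+2)^{2.8}` (regime self-maintenance needs `L^{0.2} ≥ 80`, i.e. `L ≥ 2^32`; growth beats
`volume^{1/2}` since `L³/80 > (L+2)^{3/2}`). -/
def SuperFractalGrowth : Prop :=
  ∃ L : ℕ, 2 ^ 32 ≤ L ∧ ∃ m₀ : ℕ, ∀ p : unitInterval, p < criticalProbI 3 → ∀ m : ℕ, m₀ ≤ m →
    (m : ℝ) ^ (2.8 : ℝ) ≤ (freeTypicalMax p m : ℝ) →
      (L : ℝ) ^ 3 / 80 * (freeTypicalMax p m : ℝ) ≤ (freeTypicalMax p ((L + 2) * m) : ℝ)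

/-- Centres of the disjoint translates `Λ_m(c)`, `c ∈ (2m+1)·Λ_R`, `R = ⌊(Lm-m)/(2m+1)⌋`, so that every
translate lies inside `Λ_{Lm}` for EVERY `m ≥ 1` (no `m ≥ L/2` packing condition); their number is
`(2R+1)³ ≥ 0.28 L³` for large `L`, so `≥ 0.1 L³` of them are fat w.p. `≥ 9/10` in the regime (binomial, `P(fat) > e⁻¹`). -/
def subboxCentres (L m : ℕ) : Finset V3 :=
  (box 3 ((L * m - m) / (2 * m + 1))).image fun z : V3 => (2 * (m : ℤ) + 1) • z

/-- The fat sub-boxes: translates carrying a free cluster of at least `t` vertices. -/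
def fatSubboxes (L m t : ℕ) (ω : BondConfig V3) : Finset V3 :=
  (subboxCentres L m).filter fun c => ∃ v ∈ boxAt c m, t ≤ inClusterCard (boxAt c m) ω v

/-- **Giant-fraction event** `GF(L, m, t)`: some vertex of `Λ_{(L+2)m}` is joined inside `Λ_{(L+2)m}`
to a fat cluster of at least a quarter of the fat sub-boxes.  Tolerates up to 75 % of the fat pieces
being isolated (contrast `Cohere`, which tolerates at most one isolated fat piece). -/
def GiantFraction (L m t : ℕ) : Set (BondConfig V3) :=
  {ω | ∃ x ∈ box 3 ((L + 2) * m),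
      (fatSubboxes L m t ω).card ≤ 4 *
        ((fatSubboxes L m t ω).filter fun c => ∃ v ∈ boxAt c m,
            t ≤ inClusterCard (boxAt c m) ω v ∧
            ω ∈ openConnIn (↑(box 3 ((L + 2) * m)) : Set V3) x v).card}

/-- **SuperFractalGiantFraction** (the sharpened C⁺): in the regime, `P_p(GF(L, m, M_m/2)) ≥ 1/2`.
With `≥ 0.1 L³` fat sub-boxes w.p. `≥ 9/10` (binomial) this gives `P(freeMax_{(L+2)m} ≥ L³M_m/80) ≥ 0.4 > e⁻¹`,
i.e. `SuperFractalGrowth`; the rest of the card (sharpness contradiction, continuity, `FA₂ ≤ 4M_m/|Λ_m|`)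
is unchanged. -/
def SuperFractalGiantFraction : Prop :=
  ∃ L : ℕ, 2 ^ 32 ≤ L ∧ ∃ m₀ : ℕ, ∀ p : unitInterval, p < criticalProbI 3 → ∀ m : ℕ, m₀ ≤ m →
    (m : ℝ) ^ (2.8 : ℝ) ≤ (freeTypicalMax p m : ℝ) →
      (1 : ℝ) / 2 ≤ (bondPercolation (zdGraph 3) p).real (GiantFraction L m (freeTypicalMax p m / 2))

/-! ## §3 Card `blocking-quarantine-wiring`: the second Transfer is summit-strength -/

/-- `r4 ∧ PolyFiniteTail ⇒ θ(p_c) = 0` directly (QuarantineSandwich at `x = 0`, `m = n`: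
`u_n · θ ≤ u_n · P(|K_{B(n)}(0)| ≥ n) ≤ P(n ≤ |C(0)| < ∞) ≤ C n^{-κ}`, and r4 at `s = κ/2`), so the
card's `blocking_polyTail_freeBoxSparse` is this composed with `freeBoxSparse_of_continuity`. -/
def blocking_polyTail_continuity : Prop :=
  Theses.PercNonProliferation.SubpolynomialBlocking → PolyFiniteTail → _root_.PercolationContinuityZ3

end Summit.CriticalPhenomena.PercolationContinuityZ3.Cruxes.FreeBoxSparse.TriageR1K1g2
end
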